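import Summits.QuantumFields.YangMills.Theorems.LuscherReductionTwistedTraceScalingShellLogRecord
import Summits.QuantumFields.YangMills.Theorems.LuscherReductionTwistedTraceScalingValleyLogTwoZone
import Summits.QuantumFields.YangMills.Theorems.LuscherReductionTwistedTraceScalingValleyLogFloor
import HarnessLib

/-!
# R5 — THE VALLEY GAIN WITH LOG RATE at every core radius `β^{−a}`, `0 < a < 1/5`: `ValleyGainLogAt L (powScale a) (powScale (17/20))` UNCONDITIONAL for `L ≥ 2`
# (lane A of S-BASE, crux `TwistedTraceScaling` stmt-QuantumFields-20203, line «twolattice», stub `stub_fixedLatticeTraceLaw`; hand A for lead g24; card `Lines-window-floor.md` §3 R5)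

The log-rate twin of ✓`valleyGain_record` (✓`…ValleyGainRecord`), assembled from R2–R4: start from `V_log(1/40)` (R4 ✓`valleyGainLog_fortieth`) and push the gain up a GEOMETRIC chain of
thin log-shells `(a, 4a/5)` (R2 ✓`innerShellGainSmallLogAt_record`: `3a/2 < 2·(4a/5)`, both exponents in `(0, 1/5)`; R3 ✓`valleyGainLogAt_pow_of_shellSmallLog`), by induction on the
number of shells (`(5/4)^{10}/40 ≥ 1/5` covers the whole range); below `1/40` by antitonicity (✓`valleyGainLogAt_pow_mono`).  Any finite chain with consecutive ratios `< 4/3` would do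
(cdisprove R71 `chain_lower_bound`); the ratio `5/4` keeps every domination margin `2b − 3a/2 = a/10` proportional to the exponent.
* `valleyGainLog_step` — one thin log-shell: `V_log(b) → V_log(a)` for `0 < b < 1/5`, `0 < a < 1/5`, `3a/2 < 2b`;
* `valleyGainLog_geometric` — the induction: `V_log(a)` for every `0 < a ≤ (5/4)^n/40`, `a < 1/5`;
* ★★★ `valleyGainLog_record (hL2 : 2 ≤ L) (ha0 : 0 < a) (ha5 : a < 1/5) : ValleyGainLogAt L (powScale a) (powScale (17/20))`;
* `shellGainLog_record` — hence `InnerShellGainSmallLogAt L (powScale a) (powScale b) (powScale (17/20))` for every outer exponent `b` (a shell function is a valley function).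
HONEST FRAMING: fixed lattice size `L ≥ 2`, eventually in `β` (`L`-dependent, astronomically large thresholds); by-products for W(L) of stub S-BASE of a child of the CONDITIONAL reduction
route R2b1; W(L), `stub_cmpTwoLoop`, `stub_labelTracking` and the crux `TwistedTraceScaling` are OPEN; not infinite volume, not a mass gap, not Clay.  No definitions, no `sorry`.
-/

set_option autoImplicit false

noncomputable section

open MeasureTheory Filter Topology Real
open scoped BigOperators
open Literature.MathematicalPhysics.QuantumFieldTheory
open Literature.MathematicalPhysics.QuantumLattice

namespace Summit.QuantumFields.YangMills.Theorems.FemtoTransferGap.TwoLattice.ConstTube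

open Summit.QuantumFields.YangMills.Theorems.FemtoTransferGap

variable {L : ℕ} [NeZero L]

/-- **One thin log-shell**: `V_log(b) → V_log(a)` for `0 < b < 1/5`, `0 < a < 1/5`, `3a/2 < 2b` (R2's unconditional shell + R3's two-zone composition; `b < 1/3`).
[cite: Luscher1983, §3] [cite: LuscherMunster1984, §2] -/
theorem valleyGainLog_step (hL2 : 2 ≤ L) {a b : ℝ} (hb0 : 0 < b) (hb5 : b < 1 / 5) (ha0 : 0 < a) (hab : 3 * a / 2 < 2 * b) (ha5 : a < 1 / 5)
    (hV : ValleyGainLogAt L (powScale b) (powScale (17 / 20))) : ValleyGainLogAt L (powScale a) (powScale (17 / 20)) :=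
  valleyGainLogAt_pow_of_shellSmallLog hb0 (by linarith) (innerShellGainSmallLogAt_record hL2 hb0 hb5 ha0 hab ha5 (17 / 20)) hV

/-- **The geometric chain**: for every `n`, `V_log(a)` holds for all `0 < a ≤ (5/4)^n/40` with `a < 1/5` (induction on `n`; the step uses the shell `(a, 4a/5)`). [cite: Luscher1983, §3] -/
theorem valleyGainLog_geometric (hL2 : 2 ≤ L) (n : ℕ) :
    ∀ a : ℝ, 0 < a → a ≤ (5 / 4 : ℝ) ^ n / 40 → a < 1 / 5 → ValleyGainLogAt L (powScale a) (powScale (17 / 20)) := by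
  induction n with
  | zero =>
    intro a _ ha _
    rw [pow_zero] at ha
    exact valleyGainLogAt_pow_mono (by linarith) (valleyGainLog_fortieth hL2)
  | succ n ih =>
    intro a ha0 ha ha5
    have hpow : (0 : ℝ) < (5 / 4 : ℝ) ^ n := pow_pos (by norm_num) n
    have hb : 4 * a / 5 ≤ (5 / 4 : ℝ) ^ n / 40 := by
      rw [pow_succ] at ha
      linarith
    have hVb := ih (4 * a / 5) (by linarith) hb (by linarith)
    exact valleyGainLog_step hL2 (b := 4 * a / 5) (by linarith) (by linarith) ha0 (by linarith) ha5 hVb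

/-- ★★★ **THE VALLEY GAIN WITH LOG RATE AT EVERY CORE RADIUS** `β^{−a}`, `0 < a < 1/5`: `ValleyGainLogAt L (powScale a) (powScale (17/20))`, unconditional for `L ≥ 2` (ten shells:
`(5/4)^{10}/40 ≥ 1/5`). [cite: Luscher1983, §3] [cite: LuscherMunster1984, §2] -/
theorem valleyGainLog_record (hL2 : 2 ≤ L) {a : ℝ} (ha0 : 0 < a) (ha5 : a < 1 / 5) : ValleyGainLogAt L (powScale a) (powScale (17 / 20)) :=
  valleyGainLog_geometric hL2 10 a ha0 (by norm_num at ha5 ⊢; linarith) ha5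

/-- **THE SHELL GAIN WITH LOG RATE AT EVERY PAIR OF RADII** at the record layer: `InnerShellGainSmallLogAt L (powScale a) (powScale b) (powScale (17/20))` for `0 < a < 1/5` and ANY outer
exponent `b` (a shell function is a valley function). [cite: Luscher1983, §3] -/
theorem shellGainLog_record (hL2 : 2 ≤ L) {a : ℝ} (ha0 : 0 < a) (ha5 : a < 1 / 5) (b : ℝ) :
    InnerShellGainSmallLogAt L (powScale a) (powScale b) (powScale (17 / 20)) := by
  intro c
  obtain ⟨β0, h⟩ := valleyGainLog_record hL2 ha0 ha5 c
  exact ⟨β0, fun β hβ φ hφ hsupp => h β hβ φ hφ fun U hU => ⟨(hsupp U hU).1, (hsupp U hU).2.2⟩⟩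

end Summit.QuantumFields.YangMills.Theorems.FemtoTransferGap.TwoLattice.ConstTube

end
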